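import Mathlib
import Literature.NumberTheory.LFunctions.Zhang2022.SkeletonPartThree
import Literature.NumberTheory.LFunctions.Zhang2022.TypedAppendixB
import Literature.NumberTheory.LFunctions.Zhang2022.SkeletonAlpha1
import Literature.NumberTheory.LFunctions.Zhang2022.AppendixBLemma151Circles
import Literature.NumberTheory.LFunctions.Zhang2022.AppendixBLemma151Mu3Circles
import Literature.NumberTheory.LFunctions.Zhang2022.AppendixBRectEqCircleGeneric
import Literature.NumberTheory.LFunctions.Zhang2022.Section8Lemma84Contour
import Literature.NumberTheory.LFunctions.ZetaClassicalRegionBounds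

/-!
# Zhang (2022) Appendix B, proof of Lemma 15.1: the line-to-circle step, GENERIC in `(P_μ, β)` —
# Part II: the vertical line `Re s = 1` minus the circle `|s| = 5α` is `O(1/log P_μ) = O(α)`

Topic `Literature/NumberTheory/LFunctions/Zhang2022` (Landau–Siegel audit tree; verdict-neutral).
Y. Zhang, *Discrete mean estimates and the Landau–Siegel zero*, arXiv:2211.02515v1 (2022)
[Zhang2022LandauSiegel] — **an unrefereed manuscript under adjudication; nothing in this file asserts
any claim of the manuscript beyond the estimates it PROVES.** ZHANG-L discharge lane (WP15, App. B
blocks B1/B3/B4 under leaf `Typed.Section15C.Eq15_22` / Lemma 15.1 χR), DAG node `Z22:§B.u009` (text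
after the display) [Z22 p.107, tex L5298] and its `μ = 3`, `μ = 1` twins (tex L5310–L5311): "In a way
similar to the proof of Lemma 8.1, we see that the right side is equal to the sum of the residues of the
integrand at `s = 0` and `s = β` plus an acceptable error."

For the Perron integrand `F(s) = ζ(1+s)/ζ(1+s−β_j)·(P_μ/l₁)ˢ/((log P_μ)(s−β)²)`
(`zetaRatio c′ D j s * kerB P_μ β l₁ s`, ANY `P_μ > 1` with `log P_μ ≥ 𝓛⁹/4`, `P_μ/l₁ ≥ T`, and ANY purely
imaginary `β ≠ 0, β_j`, `‖β‖ ≤ 3α`) this file proves the pieces of the Landau contour argument in the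
architecture of zl-w15-p3's `μ = 2` B1 (box of fixed size around the poles, tails on `Re s = ε = 1/log x`):

* `norm_zetaRatio_kerB` — the norm of `F` on a point, in terms of `‖ζ(1+s)‖`, `‖ζ(1+s−β_j)⁻¹‖`,
  `x^{Re s}`, `‖s−β‖`;
* `norm_tails_le_gen` — on `Re s = ε`, `|t| ≥ δ′`: `‖∫_{t>δ′} F‖ + ‖∫_{t<−δ′} F‖ ≤ K_tail(C,δ′)/log P_μ`
  (`|x^s| = e`, `‖ζ(1+s)‖ ≤ C log(|t|+3) + 1/|t|`, `‖ζ(1+s−β_j)⁻¹‖ ≤ 2C log(|t|+3)` from the tree's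
  `ZetaClassicalRegion.exists_zeroFreeRegion_bounds`, `log y ≤ 4y^{1/4}`, `∫_{δ′}^∞ t^{−3/2} = 2/√δ′`);
* `norm_horizontal_le_gen`, `norm_left_le_gen` — the three sides of the box `[−δ′, ε] × [−δ′, δ′]`
  (`δ′ ≤ c̄`, inside the classical zero-free region) are `≤ K/log P_μ`;
* `vline_sub_circle_le_of_shift` — ASSEMBLY, taking the vertical-line shift `Re s = 1 → Re s = ε` and the
  integrability on `Re s = ε` as hypotheses (block (P2a), zl-closer-4's `AppendixBLineShiftGeneric`):
  `‖vline 1 F − (2πi)⁻¹∮_{|s|=5α} F‖ ≤ C·α` with an ABSOLUTE `C` (the rectangle = circle identity is Part I,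
  `rect_eq_circle_gen_of_le`; the line decomposition is the tree's `Lemma84.integral_line_decomp`).

WHAT THIS IS NOT: the residue VALUES, Lemma 15.1, or any claim about Theorems 1–2 / Landau–Siegel zeros.

## References

* Y. Zhang, arXiv:2211.02515v1 (2022), App. B p. 107. [cite: Zhang2022LandauSiegel, App. B p.107]
* E. C. Titchmarsh, *The Theory of the Riemann Zeta-Function*, 2nd ed., Thm 3.11 (3.11.7)–(3.11.8)
  (the classical region bounds, tree `ZetaClassicalRegionBounds`). [cite: Titchmarsh1986, Theorem 3.11]
* H. L. Montgomery, R. C. Vaughan, *Multiplicative Number Theory I*, CUP 2007, §6.2 (Landau's contour).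
  [cite: MontgomeryVaughan2007, §6.2]
-/

noncomputable section

open Complex Real Metric Set Filter Topology MeasureTheory intervalIntegral

namespace Literature.NumberTheory.LFunctions.Zhang2022.Typed.AppendixB

open Literature.NumberTheory.LFunctions.Zhang2022.Skeleton
open Literature.Analysis.Complex (rectBoundaryIntegral)

/-! ## Pointwise facts -/

section Pointwise

variable (c' : ℝ)

/-- **The norm of the integrand at a point**: for `x = P_μ/l₁ > 0`, `log P_μ > 0` and `s ≠ β`,
`‖ζ(1+s)/ζ(1+s−β_j)·(P_μ/l₁)ˢ/((log P_μ)(s−β)²)‖ = ‖ζ(1+s)‖·‖ζ(1+s−β_j)⁻¹‖·x^{Re s}/((log P_μ)‖s−β‖²)`.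
[cite: Zhang2022LandauSiegel, App. B p.107] -/
theorem norm_zetaRatio_kerB (D j : ℕ) {Pμ : ℝ} {l₁ : ℕ} (β : ℂ) (hx : 0 < Pμ / l₁)
    (hL : 0 < Real.log Pμ) (s : ℂ) :
    ‖zetaRatio c' D j s * kerB Pμ β l₁ s‖ =
      ‖riemannZeta (1 + s)‖ * ‖(riemannZeta (1 + s - betaJ c' D j))⁻¹‖ * (Pμ / l₁) ^ s.re /
        (Real.log Pμ * ‖s - β‖ ^ 2) := by
  rw [zetaRatio, kerB, norm_mul, norm_div, norm_div, norm_mul, norm_pow,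
    Complex.norm_cpow_eq_rpow_re_of_pos hx, Complex.norm_real, Real.norm_of_nonneg hL.le, norm_inv]
  ring

/-- `log 43 < 4` (`e > 2.7`, `2.7⁴ > 43`). [folklore] -/
private theorem log_43_lt_four : Real.log 43 < 4 := by
  have he : (2.7 : ℝ) < Real.exp 1 := lt_trans (by norm_num) Real.exp_one_gt_d9
  have h4 : (43 : ℝ) < Real.exp 4 := by
    have : Real.exp 4 = (Real.exp 1) ^ 4 := by rw [← Real.exp_nat_mul]; norm_num
    rw [this]
    have h27 : (43 : ℝ) < 2.7 ^ 4 := by norm_num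
    exact h27.trans (pow_lt_pow_left₀ he (by norm_num) (by norm_num))
  calc Real.log 43 < Real.log (Real.exp 4) := Real.log_lt_log (by norm_num) h4
    _ = 4 := Real.log_exp 4

/-- Points of the small box lie in the GPY region: if `|Im s| ≤ 40` and `Re s ≥ 1 − c̄` then
`Re s ≥ 1 − 4c̄/log(|Im s|+3)` (`log 43 < 4`). [folklore] -/
private theorem region_of_box {cbar : ℝ} (hcb : 0 ≤ cbar) {s : ℂ} (him : |s.im| ≤ 40)
    (hre : 1 - cbar ≤ s.re) : 1 - 4 * cbar / Real.log (|s.im| + 3) ≤ s.re := by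
  have hL1 : 1 < Real.log (|s.im| + 3) :=
    Literature.NumberTheory.LFunctions.ZetaClassicalRegion.one_lt_log_abs_add_three s.im
  have hL4 : Real.log (|s.im| + 3) ≤ 4 := by
    have : Real.log (|s.im| + 3) ≤ Real.log 43 :=
      Real.log_le_log (by linarith [abs_nonneg s.im]) (by linarith)
    linarith [log_43_lt_four]
  have : cbar ≤ 4 * cbar / Real.log (|s.im| + 3) := by
    rw [le_div_iff₀ (by linarith)]; nlinarith
  linarith

/-- Points right of the `1`-line lie in the GPY region trivially. [folklore] -/
private theorem region_of_one_le_re {cbar : ℝ} (hcb : 0 ≤ cbar) {s : ℂ} (hre : 1 ≤ s.re) :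
    1 - 4 * cbar / Real.log (|s.im| + 3) ≤ s.re := by
  have hL1 : 1 < Real.log (|s.im| + 3) :=
    Literature.NumberTheory.LFunctions.ZetaClassicalRegion.one_lt_log_abs_add_three s.im
  have : 0 ≤ 4 * cbar / Real.log (|s.im| + 3) := by positivity
  linarith

/-- `ζ` near and right of the `1`-line from the region package: `‖ζ(w)‖ ≤ C log(|Im w|+3) + 1/‖w − 1‖`.
[cite: Titchmarsh1986, Theorem 3.11] -/
theorem norm_zeta_le_of_region {C : ℝ} {w : ℂ} (hw1 : w ≠ 1)
    (h : ‖riemannZeta w - 1 / (w - 1)‖ ≤ C * Real.log (|w.im| + 3)) :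
    ‖riemannZeta w‖ ≤ C * Real.log (|w.im| + 3) + 1 / ‖w - 1‖ := by
  have hsub : w - 1 ≠ 0 := sub_ne_zero.mpr hw1
  calc ‖riemannZeta w‖ = ‖(riemannZeta w - 1 / (w - 1)) + 1 / (w - 1)‖ := by ring_nf
    _ ≤ ‖riemannZeta w - 1 / (w - 1)‖ + ‖1 / (w - 1)‖ := norm_add_le _ _
    _ ≤ C * Real.log (|w.im| + 3) + 1 / ‖w - 1‖ := by rw [norm_div, norm_one]; linarith

/-- `log y ≤ 4·y^{1/4}` for `y ≥ 0` (Mathlib `Real.log_le_rpow_div`). [folklore] -/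
private theorem log_le_four_mul_rpow_quarter {y : ℝ} (hy : 0 ≤ y) : Real.log y ≤ 4 * y ^ (1 / 4 : ℝ) := by
  have := Real.log_le_rpow_div hy (by norm_num : (0 : ℝ) < 1 / 4)
  linarith [show y ^ (1 / 4 : ℝ) / (1 / 4) = 4 * y ^ (1 / 4 : ℝ) by ring]

/-- For `|t| ≥ δ′ > 0`: `(|t| + 3)^{1/2} ≤ (1 + 3/δ′)·|t|^{1/2}`. [folklore] -/
private theorem sqrt_abs_add_three_le {δ' t : ℝ} (hδ : 0 < δ') (ht : δ' ≤ |t|) :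
    (|t| + 3) ^ (1 / 2 : ℝ) ≤ (1 + 3 / δ') * |t| ^ (1 / 2 : ℝ) := by
  have ht0 : 0 < |t| := lt_of_lt_of_le hδ ht
  have h1 : |t| + 3 ≤ (1 + 3 / δ') * |t| := by
    rw [add_mul, one_mul, add_le_add_iff_left, div_mul_eq_mul_div, le_div_iff₀ hδ]
    nlinarith
  have h3δ : (0 : ℝ) < 3 / δ' := by positivity
  have h13 : (1 : ℝ) ≤ 1 + 3 / δ' := by linarith
  calc (|t| + 3) ^ (1 / 2 : ℝ) ≤ ((1 + 3 / δ') * |t|) ^ (1 / 2 : ℝ) :=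
        Real.rpow_le_rpow (by positivity) h1 (by norm_num)
    _ = (1 + 3 / δ') ^ (1 / 2 : ℝ) * |t| ^ (1 / 2 : ℝ) :=
        Real.mul_rpow (by positivity) (abs_nonneg t)
    _ ≤ (1 + 3 / δ') * |t| ^ (1 / 2 : ℝ) := by
        apply mul_le_mul_of_nonneg_right _ (by positivity)
        calc (1 + 3 / δ') ^ (1 / 2 : ℝ) ≤ (1 + 3 / δ') ^ (1 : ℝ) :=
              Real.rpow_le_rpow_of_exponent_le h13 (by norm_num)
          _ = 1 + 3 / δ' := Real.rpow_one _

/-- `log(|t|+3)·(C log(|t|+3) + 1/δ′) ≤ (16C + 4/δ′)(1 + 3/δ′)·|t|^{1/2}` for `|t| ≥ δ′ > 0`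
(`log y ≤ 4y^{1/4}`, `y^{1/4} ≤ y^{1/2}` for `y ≥ 1`). [folklore] -/
private theorem log_growth_le {C δ' t : ℝ} (hC : 0 ≤ C) (hδ : 0 < δ') (ht : δ' ≤ |t|) :
    Real.log (|t| + 3) * (C * Real.log (|t| + 3) + 1 / δ') ≤
      (16 * C + 4 / δ') * (1 + 3 / δ') * |t| ^ (1 / 2 : ℝ) := by
  set y : ℝ := |t| + 3 with hy
  have hy3 : 3 ≤ y := by rw [hy]; linarith [abs_nonneg t]
  have hy1 : 1 ≤ y := by linarith
  have hL0 : 0 ≤ Real.log y := Real.log_nonneg hy1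
  have hL4 : Real.log y ≤ 4 * y ^ (1 / 4 : ℝ) := log_le_four_mul_rpow_quarter (by linarith)
  have hq : y ^ (1 / 4 : ℝ) ≤ y ^ (1 / 2 : ℝ) :=
    Real.rpow_le_rpow_of_exponent_le hy1 (by norm_num)
  have hqq : y ^ (1 / 4 : ℝ) * y ^ (1 / 4 : ℝ) = y ^ (1 / 2 : ℝ) := by
    rw [← Real.rpow_add (by linarith)]; norm_num
  have hq0 : 0 ≤ y ^ (1 / 4 : ℝ) := by positivity
  have hs : y ^ (1 / 2 : ℝ) ≤ (1 + 3 / δ') * |t| ^ (1 / 2 : ℝ) := sqrt_abs_add_three_le hδ ht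
  have hδinv : 0 < 1 / δ' := by positivity
  -- `log y · (C log y + 1/δ′) ≤ 4y^{1/4}(4C y^{1/4} + 1/δ′) ≤ 16C y^{1/2} + (4/δ′) y^{1/2}`
  calc Real.log y * (C * Real.log y + 1 / δ')
      ≤ (4 * y ^ (1 / 4 : ℝ)) * (C * (4 * y ^ (1 / 4 : ℝ)) + 1 / δ') := by
        apply mul_le_mul hL4 _ (by positivity) (by positivity)
        nlinarith
    _ = 16 * C * (y ^ (1 / 4 : ℝ) * y ^ (1 / 4 : ℝ)) + 4 / δ' * y ^ (1 / 4 : ℝ) := by ring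
    _ ≤ 16 * C * y ^ (1 / 2 : ℝ) + 4 / δ' * y ^ (1 / 2 : ℝ) := by
        rw [hqq]; gcongr
    _ = (16 * C + 4 / δ') * y ^ (1 / 2 : ℝ) := by ring
    _ ≤ (16 * C + 4 / δ') * ((1 + 3 / δ') * |t| ^ (1 / 2 : ℝ)) := by
        apply mul_le_mul_of_nonneg_left hs; positivity
    _ = (16 * C + 4 / δ') * (1 + 3 / δ') * |t| ^ (1 / 2 : ℝ) := by ring

end Pointwise

/-! ## The pieces of the contour: tails on `Re s = ε`, the three sides of the box -/

section Pieces

variable (c' : ℝ)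

/-- **The integrand on the line `Re s = ε` beyond the box**, pointwise: with the region package
(`ζ ≠ 0`, `‖ζ(w) − 1/(w−1)‖, ‖ζ(w)⁻¹‖ ≤ C log(|Im w|+3)` for `Re w ≥ 1 − 4c̄/log(|Im w|+3)`), for
`s = ε + it`, `0 < ε`, `ε·log x = 1` (`x = P_μ/l₁`), `|t| ≥ δ′`, `‖β‖ ≤ δ′/2`, `‖β_j‖ ≤ 1`, `Re β_j = 0`:
`‖F(s)‖ ≤ 8e·C·log(|t|+3)(C log(|t|+3) + 1/δ′)/((log P_μ) t²)`.
[cite: Zhang2022LandauSiegel, App. B p.107] -/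
theorem norm_integrand_tail_le {cbar C : ℝ} (hcb : 0 ≤ cbar) (hC : 0 ≤ C)
    (hreg : ∀ s : ℂ, s ≠ 1 → 1 - 4 * cbar / Real.log (|s.im| + 3) ≤ s.re →
      riemannZeta s ≠ 0 ∧ ‖riemannZeta s - 1 / (s - 1)‖ ≤ C * Real.log (|s.im| + 3) ∧
        ‖(riemannZeta s)⁻¹‖ ≤ C * Real.log (|s.im| + 3) ∧
        ‖deriv riemannZeta s / riemannZeta s + 1 / (s - 1)‖ ≤ C * Real.log (|s.im| + 3))
    {D j : ℕ} {Pμ : ℝ} {l₁ : ℕ} {β : ℂ} {ε δ' : ℝ} (hx : 0 < Pμ / l₁) (hL : 0 < Real.log Pμ)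
    (hε : 0 < ε) (hεx : ε * Real.log (Pμ / l₁) = 1) (hδ : 0 < δ') (hβ : ‖β‖ ≤ δ' / 2)
    (hbn : ‖betaJ c' D j‖ ≤ 1) (hbre : (betaJ c' D j).re = 0) {t : ℝ} (ht : δ' ≤ |t|) :
    ‖zetaRatio c' D j (((ε : ℝ) : ℂ) + (t : ℂ) * I) * kerB Pμ β l₁ (((ε : ℝ) : ℂ) + (t : ℂ) * I)‖ ≤
      8 * Real.exp 1 * C * (Real.log (|t| + 3) * (C * Real.log (|t| + 3) + 1 / δ')) /
        (Real.log Pμ * t ^ 2) := by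
  set s : ℂ := ((ε : ℝ) : ℂ) + (t : ℂ) * I with hsdef
  set b := betaJ c' D j with hbdef
  have hsre : s.re = ε := by simp [hsdef]
  have hsim : s.im = t := by simp [hsdef]
  have ht0 : 0 < |t| := lt_of_lt_of_le hδ ht
  have ht2 : 0 < t ^ 2 := by rw [← sq_abs]; positivity
  rw [norm_zetaRatio_kerB c' D j β hx hL s]
  -- `x^{Re s} = e`
  have hxe : (Pμ / l₁) ^ s.re = Real.exp 1 := by
    rw [hsre, Real.rpow_def_of_pos hx, mul_comm, hεx]
  -- `ζ(1+s)`: region right of the 1-line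
  have hw1 : (1 : ℂ) + s ≠ 1 := by
    intro h
    have : s = 0 := by linear_combination h
    have := congrArg Complex.im this
    rw [hsim] at this; simp at this; rw [this, abs_zero] at ht0; exact lt_irrefl _ ht0
  have hwre : 1 ≤ ((1 : ℂ) + s).re := by simp [hsre, hε.le]
  obtain ⟨-, hζ1, -, -⟩ := hreg (1 + s) hw1 (region_of_one_le_re hcb hwre)
  have hwim : ((1 : ℂ) + s).im = t := by simp [hsim]
  have hζ : ‖riemannZeta (1 + s)‖ ≤ C * Real.log (|t| + 3) + 1 / δ' := by
    have h := norm_zeta_le_of_region hw1 hζ1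
    rw [hwim, add_sub_cancel_left] at h
    have hs_norm : |t| ≤ ‖s‖ := by
      have := Complex.abs_im_le_norm s; rwa [hsim] at this
    have : 1 / ‖s‖ ≤ 1 / δ' := div_le_div_of_nonneg_left zero_le_one hδ (ht.trans hs_norm)
    linarith
  -- `ζ(1+s−b)⁻¹`: right of the 1-line, imaginary part `t − Im b`
  have hw'1 : (1 : ℂ) + s - b ≠ 1 := by
    intro h
    have := congrArg Complex.re h
    simp [hsre, hbre] at this
    linarith
  have hw're : 1 ≤ ((1 : ℂ) + s - b).re := by simp [hsre, hbre, hε.le]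
  obtain ⟨-, -, hζ2, -⟩ := hreg (1 + s - b) hw'1 (region_of_one_le_re hcb hw're)
  have hζ' : ‖(riemannZeta (1 + s - b))⁻¹‖ ≤ 2 * C * Real.log (|t| + 3) := by
    have him' : ((1 : ℂ) + s - b).im = t - b.im := by simp [hsim]
    rw [him'] at hζ2
    have hbim : |b.im| ≤ 1 := (Complex.abs_im_le_norm b).trans hbn
    have hlog : Real.log (|t - b.im| + 3) ≤ Real.log (|t| + 4) := by
      apply Real.log_le_log (by positivity)
      have := abs_sub t b.im; linarith
    have h4 := Literature.NumberTheory.LFunctions.ZetaClassicalRegion.log_abs_add_four_le t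
    calc ‖(riemannZeta (1 + s - b))⁻¹‖ ≤ C * Real.log (|t - b.im| + 3) := hζ2
      _ ≤ C * (2 * Real.log (|t| + 3)) := by
          apply mul_le_mul_of_nonneg_left _ hC; linarith
      _ = 2 * C * Real.log (|t| + 3) := by ring
  -- `‖s − β‖ ≥ |t|/2`
  have hsβ : |t| / 2 ≤ ‖s - β‖ := by
    have h1 : |(s - β).im| ≤ ‖s - β‖ := Complex.abs_im_le_norm _
    have h2 : (s - β).im = t - β.im := by simp [hsim]
    have hβim : |β.im| ≤ δ' / 2 := (Complex.abs_im_le_norm β).trans hβ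
    have h3 : |t| - δ' / 2 ≤ |t - β.im| := by have := abs_sub_abs_le_abs_sub t β.im; linarith
    rw [h2] at h1
    linarith
  have hsβ2 : t ^ 2 / 4 ≤ ‖s - β‖ ^ 2 := by
    have h0 : 0 ≤ |t| / 2 := by positivity
    have := pow_le_pow_left₀ h0 hsβ 2
    rw [div_pow, sq_abs] at this; norm_num at this; linarith
  have hsβ0 : 0 < ‖s - β‖ ^ 2 := lt_of_lt_of_le (by positivity) hsβ2
  have hlog0 : 0 ≤ Real.log (|t| + 3) :=
    le_of_lt (lt_trans zero_lt_one
      (Literature.NumberTheory.LFunctions.ZetaClassicalRegion.one_lt_log_abs_add_three t))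
  -- combine
  rw [hxe, div_le_div_iff₀ (mul_pos hL hsβ0) (mul_pos hL ht2)]
  have hA : ‖riemannZeta (1 + s)‖ * ‖(riemannZeta (1 + s - b))⁻¹‖ ≤
      (C * Real.log (|t| + 3) + 1 / δ') * (2 * C * Real.log (|t| + 3)) :=
    mul_le_mul hζ hζ' (norm_nonneg _) (by positivity)
  have hB : Real.log Pμ * t ^ 2 ≤ Real.log Pμ * (4 * ‖s - β‖ ^ 2) := by
    apply mul_le_mul_of_nonneg_left _ hL.le; linarith
  calc ‖riemannZeta (1 + s)‖ * ‖(riemannZeta (1 + s - b))⁻¹‖ * Real.exp 1 * (Real.log Pμ * t ^ 2)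
      ≤ (C * Real.log (|t| + 3) + 1 / δ') * (2 * C * Real.log (|t| + 3)) * Real.exp 1 *
          (Real.log Pμ * (4 * ‖s - β‖ ^ 2)) := by
        apply mul_le_mul (mul_le_mul_of_nonneg_right hA (Real.exp_pos 1).le) hB (by positivity)
          (by positivity)
    _ = 8 * Real.exp 1 * C * (Real.log (|t| + 3) * (C * Real.log (|t| + 3) + 1 / δ')) *
          (Real.log Pμ * ‖s - β‖ ^ 2) := by ring

/-- **The two tails** on `Re s = ε` (`|t| ≥ δ′ > 0`): with
`K_tail = 8e·C(16C + 4/δ′)(1 + 3/δ′)·2δ′^{−1/2}`,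
`‖∫_{t>δ′} F(ε+it)dt‖ + ‖∫_{t<−δ′} F(ε+it)dt‖ ≤ 2K_tail/log P_μ` (`∫_{δ′}^∞ t^{−3/2}dt = 2/√δ′`).
[cite: Zhang2022LandauSiegel, App. B p.107] [cite: MontgomeryVaughan2007, §6.2] -/
theorem norm_tails_le_gen {cbar C : ℝ} (hcb : 0 ≤ cbar) (hC : 0 ≤ C)
    (hreg : ∀ s : ℂ, s ≠ 1 → 1 - 4 * cbar / Real.log (|s.im| + 3) ≤ s.re →
      riemannZeta s ≠ 0 ∧ ‖riemannZeta s - 1 / (s - 1)‖ ≤ C * Real.log (|s.im| + 3) ∧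
        ‖(riemannZeta s)⁻¹‖ ≤ C * Real.log (|s.im| + 3) ∧
        ‖deriv riemannZeta s / riemannZeta s + 1 / (s - 1)‖ ≤ C * Real.log (|s.im| + 3))
    {D j : ℕ} {Pμ : ℝ} {l₁ : ℕ} {β : ℂ} {ε δ' : ℝ} (hx : 0 < Pμ / l₁) (hL : 0 < Real.log Pμ)
    (hε : 0 < ε) (hεx : ε * Real.log (Pμ / l₁) = 1) (hδ : 0 < δ') (hβ : ‖β‖ ≤ δ' / 2)
    (hbn : ‖betaJ c' D j‖ ≤ 1) (hbre : (betaJ c' D j).re = 0) :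
    ‖∫ t in Ioi δ', zetaRatio c' D j (((ε : ℝ) : ℂ) + (t : ℂ) * I) *
        kerB Pμ β l₁ (((ε : ℝ) : ℂ) + (t : ℂ) * I)‖ +
      ‖∫ t in Iic (-δ'), zetaRatio c' D j (((ε : ℝ) : ℂ) + (t : ℂ) * I) *
        kerB Pμ β l₁ (((ε : ℝ) : ℂ) + (t : ℂ) * I)‖ ≤
      2 * (8 * Real.exp 1 * C * ((16 * C + 4 / δ') * (1 + 3 / δ')) * (2 * δ' ^ (-(1 / 2 : ℝ))) /
          Real.log Pμ) := by
  set F : ℝ → ℂ := fun t => zetaRatio c' D j (((ε : ℝ) : ℂ) + (t : ℂ) * I) *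
    kerB Pμ β l₁ (((ε : ℝ) : ℂ) + (t : ℂ) * I) with hFdef
  set A : ℝ := 8 * Real.exp 1 * C * ((16 * C + 4 / δ') * (1 + 3 / δ')) / Real.log Pμ with hA
  have hA0 : 0 ≤ A := by positivity
  -- majorant `g(t) = A · t^{−3/2}` on `t > δ′`
  set g : ℝ → ℝ := fun t => A * t ^ (-(3 / 2 : ℝ)) with hg
  have hgi : IntegrableOn g (Ioi δ') :=
    (integrableOn_Ioi_rpow_of_lt (by norm_num : (-(3 / 2 : ℝ)) < -1) hδ).const_mul A
  have hgint : ∫ t in Ioi δ', g t = A * (2 * δ' ^ (-(1 / 2 : ℝ))) := by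
    rw [hg, MeasureTheory.integral_const_mul, integral_Ioi_rpow_of_lt (by norm_num) hδ]
    congr 1
    have : (-(3 / 2 : ℝ)) + 1 = -(1 / 2 : ℝ) := by norm_num
    rw [this]; ring
  -- pointwise bound for `|t| ≥ δ′`
  have hpt : ∀ t : ℝ, δ' ≤ |t| → ‖F t‖ ≤ A * |t| ^ (-(3 / 2 : ℝ)) := by
    intro t ht
    have ht0 : 0 < |t| := lt_of_lt_of_le hδ ht
    have h1 := norm_integrand_tail_le c' hcb hC hreg hx hL hε hεx hδ hβ hbn hbre ht
    refine h1.trans ?_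
    have h2 := log_growth_le hC hδ ht
    have ht2 : t ^ 2 = |t| ^ (2 : ℝ) := by rw [← sq_abs]; norm_cast
    have hkey : Real.log (|t| + 3) * (C * Real.log (|t| + 3) + 1 / δ') / (Real.log Pμ * t ^ 2) ≤
        ((16 * C + 4 / δ') * (1 + 3 / δ')) / Real.log Pμ * |t| ^ (-(3 / 2 : ℝ)) := by
      rw [ht2, div_le_iff₀ (by positivity)]
      calc Real.log (|t| + 3) * (C * Real.log (|t| + 3) + 1 / δ')
          ≤ (16 * C + 4 / δ') * (1 + 3 / δ') * |t| ^ (1 / 2 : ℝ) := h2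
        _ = ((16 * C + 4 / δ') * (1 + 3 / δ')) / Real.log Pμ * |t| ^ (-(3 / 2 : ℝ)) *
              (Real.log Pμ * |t| ^ (2 : ℝ)) := by
            have hsplit : |t| ^ (1 / 2 : ℝ) = |t| ^ (-(3 / 2 : ℝ)) * |t| ^ (2 : ℝ) := by
              rw [← Real.rpow_add ht0]; norm_num
            rw [hsplit]; field_simp
    calc 8 * Real.exp 1 * C * (Real.log (|t| + 3) * (C * Real.log (|t| + 3) + 1 / δ')) /
          (Real.log Pμ * t ^ 2)
        = 8 * Real.exp 1 * C * (Real.log (|t| + 3) * (C * Real.log (|t| + 3) + 1 / δ') /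
            (Real.log Pμ * t ^ 2)) := by ring
      _ ≤ 8 * Real.exp 1 * C * (((16 * C + 4 / δ') * (1 + 3 / δ')) / Real.log Pμ *
            |t| ^ (-(3 / 2 : ℝ))) := by
          apply mul_le_mul_of_nonneg_left hkey; positivity
      _ = A * |t| ^ (-(3 / 2 : ℝ)) := by rw [hA]; ring
  -- upper tail
  have hup : ‖∫ t in Ioi δ', F t‖ ≤ A * (2 * δ' ^ (-(1 / 2 : ℝ))) := by
    have hbound : ∀ᵐ t : ℝ ∂(volume.restrict (Ioi δ')), ‖F t‖ ≤ g t := by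
      refine (ae_restrict_iff' measurableSet_Ioi).2 (Eventually.of_forall fun t (ht : δ' < t) => ?_)
      have htpos : 0 < t := hδ.trans ht
      have := hpt t (by rw [abs_of_pos htpos]; exact ht.le)
      rwa [abs_of_pos htpos] at this
    exact (norm_integral_le_of_norm_le hgi hbound).trans hgint.le
  -- lower tail (reflect)
  have hlow : ‖∫ t in Iic (-δ'), F t‖ ≤ A * (2 * δ' ^ (-(1 / 2 : ℝ))) := by
    rw [← integral_comp_neg_Ioi]
    have hbound : ∀ᵐ t : ℝ ∂(volume.restrict (Ioi δ')), ‖F (-t)‖ ≤ g t := by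
      refine (ae_restrict_iff' measurableSet_Ioi).2 (Eventually.of_forall fun t (ht : δ' < t) => ?_)
      have htpos : 0 < t := hδ.trans ht
      have := hpt (-t) (by rw [abs_neg, abs_of_pos htpos]; exact ht.le)
      rwa [abs_neg, abs_of_pos htpos] at this
    exact (norm_integral_le_of_norm_le hgi hbound).trans hgint.le
  have : A * (2 * δ' ^ (-(1 / 2 : ℝ))) =
      8 * Real.exp 1 * C * ((16 * C + 4 / δ') * (1 + 3 / δ')) * (2 * δ' ^ (-(1 / 2 : ℝ))) /
        Real.log Pμ := by rw [hA]; ring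
  rw [this] at hup hlow
  linarith

/-- **The integrand on the box sides**, pointwise: if `|Im s| ∈ [?]`, more precisely for any `s` with
`1 − c̄ ≤ 1 + Re s` (i.e. `Re s ≥ −c̄`), `|Im s| ≤ 2`, `s ≠ 0`, `‖s‖ ≥ δ′`, `‖s − β‖ ≥ δ′/2`,
`Re s ≤ ε` (so `x^{Re s} ≤ e`), `1 + s − β_j ≠ 1`: `‖F(s)‖ ≤ 4e(4C + 1/δ′)(4C)/((log P_μ)δ′²)`.
[cite: Zhang2022LandauSiegel, App. B p.107] -/
theorem norm_integrand_box_le {cbar C : ℝ} (hcb : 0 ≤ cbar) (hC : 0 ≤ C)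
    (hreg : ∀ s : ℂ, s ≠ 1 → 1 - 4 * cbar / Real.log (|s.im| + 3) ≤ s.re →
      riemannZeta s ≠ 0 ∧ ‖riemannZeta s - 1 / (s - 1)‖ ≤ C * Real.log (|s.im| + 3) ∧
        ‖(riemannZeta s)⁻¹‖ ≤ C * Real.log (|s.im| + 3) ∧
        ‖deriv riemannZeta s / riemannZeta s + 1 / (s - 1)‖ ≤ C * Real.log (|s.im| + 3))
    {D j : ℕ} {Pμ : ℝ} {l₁ : ℕ} {β : ℂ} {ε δ' : ℝ} (hx1 : 1 ≤ Pμ / l₁) (hL : 0 < Real.log Pμ)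
    (hεx : ε * Real.log (Pμ / l₁) = 1) (hδ : 0 < δ')
    (hbn : ‖betaJ c' D j‖ ≤ 1) (hbre : (betaJ c' D j).re = 0) {s : ℂ}
    (hsre_lo : -cbar ≤ s.re) (hsre_hi : s.re ≤ ε) (hsim : |s.im| ≤ 2) (hs0 : s ≠ 0)
    (hsn : δ' ≤ ‖s‖) (hsβ : δ' / 2 ≤ ‖s - β‖) (hsb : s ≠ betaJ c' D j) :
    ‖zetaRatio c' D j s * kerB Pμ β l₁ s‖ ≤
      4 * Real.exp 1 * ((4 * C + 1 / δ') * (4 * C)) / (Real.log Pμ * δ' ^ 2) := by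
  set b := betaJ c' D j with hbdef
  have hx : 0 < Pμ / l₁ := lt_of_lt_of_le zero_lt_one hx1
  rw [norm_zetaRatio_kerB c' D j β hx hL s]
  -- `x^{Re s} ≤ e`
  have hxe : (Pμ / l₁) ^ s.re ≤ Real.exp 1 := by
    calc (Pμ / l₁) ^ s.re ≤ (Pμ / l₁) ^ ε := Real.rpow_le_rpow_of_exponent_le hx1 hsre_hi
      _ = Real.exp 1 := by rw [Real.rpow_def_of_pos hx, mul_comm, hεx]
  -- region facts for `1 + s` and `1 + s − b`
  have hlog4 : ∀ u : ℝ, |u| ≤ 40 → Real.log (|u| + 3) ≤ 4 := by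
    intro u hu
    have : Real.log (|u| + 3) ≤ Real.log 43 :=
      Real.log_le_log (by linarith [abs_nonneg u]) (by linarith)
    linarith [log_43_lt_four]
  have hw1 : (1 : ℂ) + s ≠ 1 := fun h => hs0 (by linear_combination h)
  have hwre : 1 - cbar ≤ ((1 : ℂ) + s).re := by simp; linarith
  have hwim : |((1 : ℂ) + s).im| ≤ 40 := by simp; linarith
  obtain ⟨-, hζ1, -, -⟩ := hreg (1 + s) hw1 (region_of_box hcb hwim hwre)
  have hζ : ‖riemannZeta (1 + s)‖ ≤ 4 * C + 1 / δ' := by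
    have h := norm_zeta_le_of_region hw1 hζ1
    rw [add_sub_cancel_left] at h
    have h1 : C * Real.log (|((1 : ℂ) + s).im| + 3) ≤ 4 * C := by
      have := hlog4 _ hwim; nlinarith
    have h2 : 1 / ‖s‖ ≤ 1 / δ' := div_le_div_of_nonneg_left zero_le_one hδ hsn
    linarith
  have hw'1 : (1 : ℂ) + s - b ≠ 1 := fun h => hsb (by linear_combination h)
  have hw're : 1 - cbar ≤ ((1 : ℂ) + s - b).re := by simp [hbre]; linarith
  have hbim : |b.im| ≤ 1 := (Complex.abs_im_le_norm b).trans hbn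
  have hw'im : |((1 : ℂ) + s - b).im| ≤ 40 := by
    have : ((1 : ℂ) + s - b).im = s.im - b.im := by simp
    rw [this]
    have := abs_sub s.im b.im; linarith
  obtain ⟨-, -, hζ2, -⟩ := hreg (1 + s - b) hw'1 (region_of_box hcb hw'im hw're)
  have hζ' : ‖(riemannZeta (1 + s - b))⁻¹‖ ≤ 4 * C := by
    have := hlog4 _ hw'im; nlinarith
  have hsβ2 : δ' ^ 2 / 4 ≤ ‖s - β‖ ^ 2 := by
    have h0 : 0 ≤ δ' / 2 := by positivity
    have := pow_le_pow_left₀ h0 hsβ 2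
    rw [div_pow] at this; norm_num at this; linarith
  have hsβ0 : 0 < ‖s - β‖ ^ 2 := lt_of_lt_of_le (by positivity) hsβ2
  rw [div_le_div_iff₀ (mul_pos hL hsβ0) (by positivity)]
  have hA : ‖riemannZeta (1 + s)‖ * ‖(riemannZeta (1 + s - b))⁻¹‖ ≤ (4 * C + 1 / δ') * (4 * C) :=
    mul_le_mul hζ hζ' (norm_nonneg _) (by positivity)
  have hB : Real.log Pμ * δ' ^ 2 ≤ Real.log Pμ * (4 * ‖s - β‖ ^ 2) := by
    apply mul_le_mul_of_nonneg_left _ hL.le; linarith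
  calc ‖riemannZeta (1 + s)‖ * ‖(riemannZeta (1 + s - b))⁻¹‖ * (Pμ / ↑l₁) ^ s.re *
        (Real.log Pμ * δ' ^ 2)
      ≤ (4 * C + 1 / δ') * (4 * C) * Real.exp 1 * (Real.log Pμ * (4 * ‖s - β‖ ^ 2)) := by
        apply mul_le_mul (mul_le_mul hA hxe (by positivity) (by positivity)) hB (by positivity)
          (by positivity)
    _ = 4 * Real.exp 1 * ((4 * C + 1 / δ') * (4 * C)) * (Real.log Pμ * ‖s - β‖ ^ 2) := by ring

end Pieces

/-! ## Assembly: the vertical line minus the circle is `O(α)` -/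

section Assembly

variable (c' : ℝ)

/-- `L₀ ≤ log D` once `D ≥ ⌈exp L₀⌉₊`. [folklore] -/
private theorem le_ell_of_ceil_exp_le₆ {L₀ : ℝ} {D : ℕ} (hD : ⌈Real.exp L₀⌉₊ ≤ D) : L₀ ≤ ell D := by
  have h : Real.exp L₀ ≤ D := le_trans (Nat.le_ceil _) (by exact_mod_cast hD)
  exact (Real.le_log_iff_exp_le (lt_of_lt_of_le (Real.exp_pos _) h)).mpr h

set_option maxHeartbeats 400000 in
/-- **The line-to-circle step, generic in `(P_μ, β)` — assembly from the vertical-line shift.** GIVEN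
the integrability of `t ↦ F(σ+it)` on every line `Re s = σ > 0` and the pole-free shift
`∫ F(1+it)dt = ∫ F(ε+it)dt` (`0 < ε ≤ 1`) for the generic integrand
`F(s) = ζ(1+s)/ζ(1+s−β_j)·(P_μ/l₁)ˢ/((log P_μ)(s−β)²)` (block (P2a), `AppendixBLineShiftGeneric`), there are
an absolute `C` and a threshold `D₀` such that for `D ≥ D₀`, every `j ∈ {1,2,3}`, every `P_μ > 1` with
`log P_μ ≥ 𝓛⁹/4`, `l₁ ≥ 1` with `P_μ/l₁ ≥ T`, and every purely imaginary `β ≠ 0, β_j` with `‖β‖ ≤ 3α`: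
`‖(1/2πi)∫_{(1)} F − (2πi)⁻¹∮_{|s|=5α} F‖ ≤ C·α` — the Landau contour: shift to `Re s = ε = 1/log(P_μ/l₁)`,
split at height `δ′` against the box `[−δ′, ε]×[−δ′, δ′]` (`Lemma84.integral_line_decomp`), box = circle
(`rect_eq_circle_gen_of_le`), tails `norm_tails_le_gen`, sides `norm_integrand_box_le`; every piece is
`≤ K/log P_μ ≤ (4K/π)·α`. [cite: Zhang2022LandauSiegel, App. B p.107] [cite: MontgomeryVaughan2007, §6.2] -/
theorem vline_sub_circle_le_of_shift
    (hint : ∀ {D j : ℕ} {Pμ : ℝ} {l₁ : ℕ} {β : ℂ} {σ : ℝ}, 1 < Pμ → 1 ≤ l₁ → β.re = 0 → 0 < σ →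
      Integrable (fun t : ℝ => zetaRatio c' D j (((σ : ℝ) : ℂ) + (t : ℂ) * I) *
        kerB Pμ β l₁ (((σ : ℝ) : ℂ) + (t : ℂ) * I)))
    (hshift : ∀ {D j : ℕ} {Pμ : ℝ} {l₁ : ℕ} {β : ℂ} {ε : ℝ}, 1 < Pμ → 1 ≤ l₁ → β.re = 0 → 0 < ε →
      ε ≤ 1 → (∫ t : ℝ, zetaRatio c' D j (((1 : ℝ) : ℂ) + (t : ℂ) * I) *
          kerB Pμ β l₁ (((1 : ℝ) : ℂ) + (t : ℂ) * I)) =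
        ∫ t : ℝ, zetaRatio c' D j (((ε : ℝ) : ℂ) + (t : ℂ) * I) *
          kerB Pμ β l₁ (((ε : ℝ) : ℂ) + (t : ℂ) * I)) :
    ∃ C : ℝ, ∃ D₀ : ℕ, ∀ D : ℕ, D₀ ≤ D → ∀ j ∈ ({1, 2, 3} : Finset ℕ),
      ∀ (Pμ : ℝ) (l₁ : ℕ) (β : ℂ), 1 < Pμ → ell D ^ 9 / 4 ≤ Real.log Pμ → 1 ≤ l₁ →
        bigT D ≤ Pμ / l₁ → β ≠ 0 → β ≠ betaJ c' D j → β.re = 0 → ‖β‖ ≤ 3 * alpha D →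
        ‖vline 1 (fun s => zetaRatio c' D j s * kerB Pμ β l₁ s) -
            (2 * π * I)⁻¹ * (∮ s in C((0 : ℂ), 5 * alpha D), zetaRatio c' D j s * kerB Pμ β l₁ s)‖ ≤
          C * alpha D := by
  obtain ⟨cbar, hcb0, hcb1, C, hC0, hreg⟩ :=
    Literature.NumberTheory.LFunctions.ZetaClassicalRegion.exists_zeroFreeRegion_bounds
  obtain ⟨δ₀, hδ₀, -, hrect⟩ := rect_eq_circle_gen_of_le c'
  set δ' : ℝ := min δ₀ (min cbar (1 / 2)) with hδ'def
  have hδ' : 0 < δ' := lt_min hδ₀ (lt_min hcb0 (by norm_num))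
  have hδ'δ₀ : δ' ≤ δ₀ := min_le_left _ _
  have hδ'cb : δ' ≤ cbar := le_trans (min_le_right _ _) (min_le_left _ _)
  have hδ'half : δ' ≤ 1 / 2 := le_trans (min_le_right _ _) (min_le_right _ _)
  obtain ⟨D₁, hD₁⟩ := hrect δ' hδ' hδ'δ₀
  -- constants
  set Ktail : ℝ := 2 * (8 * Real.exp 1 * C * ((16 * C + 4 / δ') * (1 + 3 / δ')) *
    (2 * δ' ^ (-(1 / 2 : ℝ)))) with hKtail
  set Kbox : ℝ := 4 * Real.exp 1 * ((4 * C + 1 / δ') * (4 * C)) / δ' ^ 2 with hKbox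
  have hKtail0 : 0 ≤ Ktail := by positivity
  have hKbox0 : 0 ≤ Kbox := by positivity
  set K : ℝ := Ktail + 3 * (2 * δ' * Kbox) with hK
  have hK0 : 0 ≤ K := by positivity
  refine ⟨1 / (2 * π) * K * (4 / π),
    max D₁ ⌈Real.exp (max (max (max 2 (60 * |c'| * π)) (max (10 * π / δ') (8 * 0 * π))) (1 / δ'))⌉₊,
    fun D hD j hj Pμ l₁ β hPμ hlogP hl₁ hT hβ0 hβb hβre hβ3 => ?_⟩
  have hDD₁ : D₁ ≤ D := le_trans (le_max_left _ _) hD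
  have hℓmax := le_ell_of_ceil_exp_le₆ (le_trans (le_max_right _ _) hD)
  obtain ⟨hℓ2, hc, hδα, -, hα0, hαπ, -⟩ := large_package c' hδ' le_rfl
    (le_trans (le_max_left _ _) hℓmax)
  have hℓδ : 1 / δ' ≤ ell D := le_trans (le_max_right _ _) hℓmax
  obtain ⟨-, hb4, hb2, -, -⟩ := betaJ_size c' hℓ2 hc hj
  set b := betaJ c' D j with hbdef
  set a := alpha D with hadef
  have hℓ1 : 1 ≤ ell D := by linarith
  have hb0 : b ≠ 0 := by intro h; rw [h, norm_zero] at hb2; linarith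
  have hbre : b.re = 0 := Typed.AppendixB.betaJ_re c' D j
  have hbn : ‖b‖ ≤ 1 := by
    have : a ≤ π / ell D := hαπ
    have hπℓ : π / ell D ≤ π / 2 := div_le_div_of_nonneg_left Real.pi_pos.le (by norm_num) hℓ2
    have hπ4 : π ≤ 4 := by linarith [Real.pi_lt_d2]
    linarith
  have hbδ : ‖b‖ < δ' := by linarith
  have hβδ : ‖β‖ ≤ δ' / 2 := by linarith
  -- the parameters `x = Pμ/l₁`, `ε = 1/log x`
  have hlogP0 : 0 < Real.log Pμ := Real.log_pos hPμ
  have hT1 : 1 < bigT D := by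
    rw [bigT]; exact Real.one_lt_exp_iff.mpr (Real.rpow_pos_of_pos (by linarith) _)
  have hx1 : 1 < Pμ / l₁ := lt_of_lt_of_le hT1 hT
  have hx0 : 0 < Pμ / l₁ := by linarith
  set Lx : ℝ := Real.log (Pμ / l₁) with hLx
  have hLxT : ell D ^ (1.1 : ℝ) ≤ Lx := by
    have := Real.log_le_log (by linarith) hT
    rwa [Skeleton.log_bigT] at this
  have hℓLx : ell D ≤ Lx := le_trans (Real.self_le_rpow_of_one_le hℓ1 (by norm_num)) hLxT
  have hLx0 : 0 < Lx := by linarith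
  set ε : ℝ := 1 / Lx with hεdef
  have hε : 0 < ε := by positivity
  have hεx : ε * Lx = 1 := by rw [hεdef]; field_simp
  have hεδ : ε ≤ δ' := by
    rw [hεdef, div_le_iff₀ hLx0]
    have : 1 / δ' * δ' = 1 := by field_simp
    nlinarith [hℓδ, hℓLx]
  have hε1 : ε ≤ 1 := by linarith
  -- the integrand and the pieces
  set F : ℂ → ℂ := fun s => zetaRatio c' D j s * kerB Pμ β l₁ s with hFdef
  have hintε : Integrable (fun t : ℝ => F (((ε : ℝ) : ℂ) + (t : ℂ) * I)) :=
    hint (D := D) (j := j) hPμ hl₁ hβre hε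
  have hshiftF : (∫ t : ℝ, F (((1 : ℝ) : ℂ) + (t : ℂ) * I)) =
      ∫ t : ℝ, F (((ε : ℝ) : ℂ) + (t : ℂ) * I) :=
    hshift (D := D) (j := j) (β := β) hPμ hl₁ hβre hε hε1
  have hdecomp := Lemma84.integral_line_decomp (Θ := F) (σ₀ := ε) (σ₁ := δ') (T := δ') hintε
  have hrc : rectBoundaryIntegral F (-δ') ε (-δ') δ' =
      ∮ s in C((0 : ℂ), 5 * a), F s :=
    hD₁ D hDD₁ j hj Pμ l₁ β hPμ hl₁ hβ0 hβb hβre hβ3 ε hε hεδ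
  -- names for the pieces
  set TL := ∫ t in Iic (-δ'), F (((ε : ℝ) : ℂ) + (t : ℂ) * I) with hTL
  set TR := ∫ t in Ioi δ', F (((ε : ℝ) : ℂ) + (t : ℂ) * I) with hTR
  set LF := ∫ t in (-δ')..δ', F (((-δ' : ℝ) : ℂ) + (t : ℂ) * I) with hLF
  set BT := ∫ u in (-δ')..ε, F ((u : ℂ) + ((-δ' : ℝ) : ℂ) * I) with hBT
  set TP := ∫ u in (-δ')..ε, F ((u : ℂ) + (δ' : ℂ) * I) with hTP
  set CI := ∮ s in C((0 : ℂ), 5 * a), F s with hCI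
  -- the identity: `vline 1 F − (2πi)⁻¹ CI = (1/2π)(TL + TR + LF + i·BT − i·TP)`
  have hπ0 : (π : ℂ) ≠ 0 := by exact_mod_cast Real.pi_ne_zero
  have hkey : vline 1 F - (2 * π * I)⁻¹ * CI =
      (1 / (2 * π) : ℂ) * (TL + TR + LF + I * BT - I * TP) := by
    have hv : vline 1 F = (1 / (2 * π) : ℂ) * ∫ t : ℝ, F (((ε : ℝ) : ℂ) + (t : ℂ) * I) := by
      rw [vline, hshiftF]
    rw [hv, hdecomp, hrc]
    have hI : (2 * (π : ℂ) * I)⁻¹ = -(I / (2 * π)) := by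
      have h2 : (2 * (π : ℂ) * I) * (-(I / (2 * π))) = 1 := by
        field_simp
        rw [Complex.I_sq]; ring
      exact inv_eq_of_mul_eq_one_right h2
    rw [hI]
    ring
  -- bounds for the pieces
  have htails : ‖TR‖ + ‖TL‖ ≤ Ktail / Real.log Pμ := by
    have h := norm_tails_le_gen c' hcb0.le hC0.le hreg (D := D) (j := j) hx0 hlogP0 hε hεx hδ' hβδ
      hbn hbre
    rw [hKtail]
    have e : 2 * (8 * Real.exp 1 * C * ((16 * C + 4 / δ') * (1 + 3 / δ')) * (2 * δ' ^ (-(1 / 2 : ℝ))) /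
        Real.log Pμ) = 2 * (8 * Real.exp 1 * C * ((16 * C + 4 / δ') * (1 + 3 / δ')) *
        (2 * δ' ^ (-(1 / 2 : ℝ)))) / Real.log Pμ := by ring
    rw [← e]; exact h
  -- pointwise bound on the box boundary
  have hboxpt : ∀ s : ℂ, -δ' ≤ s.re → s.re ≤ ε → |s.im| ≤ δ' → s ≠ 0 → δ' ≤ ‖s‖ →
      δ' / 2 ≤ ‖s - β‖ → s ≠ b → ‖F s‖ ≤ Kbox / Real.log Pμ := by
    intro s h1 h2 h3 h4 h5 h6 h7
    have h := norm_integrand_box_le c' hcb0.le hC0.le hreg (D := D) (j := j) (β := β) hx1.le hlogP0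
      hεx hδ' hbn hbre (s := s) (by linarith) h2 (by linarith) h4 h5 h6 h7
    rw [hKbox]
    have e : 4 * Real.exp 1 * ((4 * C + 1 / δ') * (4 * C)) / δ' ^ 2 / Real.log Pμ =
        4 * Real.exp 1 * ((4 * C + 1 / δ') * (4 * C)) / (Real.log Pμ * δ' ^ 2) := by
      rw [div_div, mul_comm (δ' ^ 2) (Real.log Pμ)]
    rw [e]; exact h
  -- horizontal sides
  have hhor : ∀ T' : ℝ, |T'| = δ' →
      ‖∫ u in (-δ')..ε, F ((u : ℂ) + (T' : ℂ) * I)‖ ≤ (ε + δ') * (Kbox / Real.log Pμ) := by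
    intro T' hT'
    refine Lemma84.norm_horizontal_le (Θ := F) (by linarith) fun u hu1 hu2 => ?_
    have hsre : ((u : ℂ) + (T' : ℂ) * I).re = u := by simp
    have hsim : ((u : ℂ) + (T' : ℂ) * I).im = T' := by simp
    refine hboxpt _ (by rw [hsre]; exact hu1) (by rw [hsre]; exact hu2) (by rw [hsim, hT'])
      ?_ ?_ ?_ ?_
    · intro h; have := congrArg Complex.im h; rw [hsim] at this; simp at this
      rw [this, abs_zero] at hT'; linarith
    · have := Complex.abs_im_le_norm ((u : ℂ) + (T' : ℂ) * I); rw [hsim, hT'] at this; exact this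
    · have h1 := Complex.abs_im_le_norm ((u : ℂ) + (T' : ℂ) * I - β)
      have h2 : ((u : ℂ) + (T' : ℂ) * I - β).im = T' - β.im := by simp
      rw [h2] at h1
      have hβim : |β.im| ≤ δ' / 2 := (Complex.abs_im_le_norm β).trans hβδ
      have h3 : |T'| - |β.im| ≤ |T' - β.im| := abs_sub_abs_le_abs_sub T' β.im
      linarith
    · intro h; have := congrArg Complex.im h; rw [hsim] at this
      have hbim : |b.im| ≤ ‖b‖ := Complex.abs_im_le_norm b
      rw [← this, hT'] at hbim; linarith
  have hBT : ‖BT‖ ≤ (ε + δ') * (Kbox / Real.log Pμ) := hhor (-δ') (by rw [abs_neg, abs_of_pos hδ'])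
  have hTP : ‖TP‖ ≤ (ε + δ') * (Kbox / Real.log Pμ) := hhor δ' (abs_of_pos hδ')
  -- left side
  have hLF : ‖LF‖ ≤ Kbox / Real.log Pμ * |δ' - -δ'| := by
    refine intervalIntegral.norm_integral_le_of_norm_le_const fun t ht => ?_
    rw [uIoc_of_le (by linarith)] at ht
    have hsre : (((-δ' : ℝ) : ℂ) + (t : ℂ) * I).re = -δ' := by simp
    have hsim : (((-δ' : ℝ) : ℂ) + (t : ℂ) * I).im = t := by simp
    refine hboxpt _ (by rw [hsre]) (by rw [hsre]; linarith) ?_ ?_ ?_ ?_ ?_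
    · rw [hsim]; exact abs_le.mpr ⟨ht.1.le, ht.2⟩
    · intro h; have := congrArg Complex.re h; rw [hsre] at this; simp at this; linarith
    · have := Complex.abs_re_le_norm (((-δ' : ℝ) : ℂ) + (t : ℂ) * I)
      rw [hsre, abs_neg, abs_of_pos hδ'] at this; exact this
    · have h1 := Complex.abs_re_le_norm (((-δ' : ℝ) : ℂ) + (t : ℂ) * I - β)
      have h2 : (((-δ' : ℝ) : ℂ) + (t : ℂ) * I - β).re = -δ' := by simp [hβre]
      rw [h2, abs_neg, abs_of_pos hδ'] at h1; linarith
    · intro h; have := congrArg Complex.re h; rw [hsre, hbre] at this; linarith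
  have hLF' : ‖LF‖ ≤ 2 * δ' * (Kbox / Real.log Pμ) := by
    have h2δ : |δ' - -δ'| = 2 * δ' := by
      rw [sub_neg_eq_add, abs_of_pos (by linarith only [hδ'])]; ring
    rw [h2δ] at hLF; linarith only [hLF]
  -- sum of the pieces
  have hεδ2 : (ε + δ') * (Kbox / Real.log Pμ) ≤ 2 * δ' * (Kbox / Real.log Pμ) := by
    have h12 : ε + δ' ≤ 2 * δ' := by linarith only [hεδ]
    have hK' : 0 ≤ Kbox / Real.log Pμ := div_nonneg hKbox0 hlogP0.le
    exact mul_le_mul_of_nonneg_right h12 hK'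
  have hsum : ‖TL + TR + LF + I * BT - I * TP‖ ≤ K / Real.log Pμ := by
    have hI1 : ‖I * BT‖ = ‖BT‖ := by rw [norm_mul, Complex.norm_I, one_mul]
    have hI2 : ‖I * TP‖ = ‖TP‖ := by rw [norm_mul, Complex.norm_I, one_mul]
    have n1 := norm_sub_le (TL + TR + LF + I * BT) (I * TP)
    have n2 := norm_add_le (TL + TR + LF) (I * BT)
    have n3 := norm_add_le (TL + TR) LF
    have n4 := norm_add_le TL TR
    have hK' : Ktail / Real.log Pμ + 3 * (2 * δ' * (Kbox / Real.log Pμ)) = K / Real.log Pμ := by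
      rw [hK]; ring
    rw [hI1] at n2; rw [hI2] at n1
    linarith only [n1, n2, n3, n4, htails, hLF', hBT, hTP, hεδ2, hK']
  -- `1/log Pμ ≤ 4/𝓛⁹ = (4/π)·α`
  have hα : a = π / ell D ^ 9 := by rw [hadef, alpha, bigP, Real.log_exp]
  have hinvlog : K / Real.log Pμ ≤ K * (4 / π) * a := by
    have hℓ9 : 0 < ell D ^ 9 / 4 := by positivity
    have h1 : K / Real.log Pμ ≤ K / (ell D ^ 9 / 4) := div_le_div_of_nonneg_left hK0 hℓ9 hlogP
    have h2 : K / (ell D ^ 9 / 4) = K * (4 / π) * a := by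
      rw [hα]; field_simp
    linarith only [h1, h2]
  rw [hkey, norm_mul]
  have hn : ‖(1 / (2 * π) : ℂ)‖ = 1 / (2 * π) := by
    rw [show (1 / (2 * π) : ℂ) = ((1 / (2 * π) : ℝ) : ℂ) by push_cast; ring, Complex.norm_real,
      Real.norm_of_nonneg (by positivity)]
  rw [hn]
  calc 1 / (2 * π) * ‖TL + TR + LF + I * BT - I * TP‖ ≤ 1 / (2 * π) * (K / Real.log Pμ) := by
        apply mul_le_mul_of_nonneg_left hsum; positivity
    _ ≤ 1 / (2 * π) * (K * (4 / π) * a) := by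
        apply mul_le_mul_of_nonneg_left hinvlog; positivity
    _ = 1 / (2 * π) * K * (4 / π) * a := by ring

end Assembly

end Literature.NumberTheory.LFunctions.Zhang2022.Typed.AppendixB
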